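import Literature.NumberTheory.ConnesConsani2021.ProlatePointwiseParseval
import Literature.NumberTheory.ConnesConsani2021.ProlateContinuation
import Literature.NumberTheory.ConnesConsani2021.ProlateEigenvalueVirial
import HarnessLib

/-!
# Derivative-Parseval for the prolate basis: `Σ_n λ(n)² ψ_n′(y)² = ‖s_y‖² = ∫_{−1}^{1} (2πx)² sin²(2πxy) dx`

LINE 1 — FRAMING: RH-FREE corpus literature (a Parseval identity for Slepian's `λ = 1` even prolate
basis `ξ_n = √2ψ_n` of `𝒫₁L²(ℝ)_ev` against the cut-off SINE-MOMENT wave `s_y`); cell rh-crit, corpus C1,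
seat t2 (hand #1, cc-lead R102 (1)(c) / R105 (1): "BANK the derivative-Parseval identity
`HasSum (fun n ↦ λ(n)²·(ψ_n′ y)²) ‖s_y‖²`, `s_y = 1_{[−1,1]}·(−2πx)sin(2πxy)`, as the first brick of the
(ii)-FULL fallback" for the (E-a) high-mode tail of K3 `WindowSpectralBound`, stmt 19306).
bears_on: W-C/W-P — K3 (E-a) certificate, tail design (ii)-FULL (documented fallback; primary = (iv)).
WHAT THIS IS NOT: a certificate, a tail bound with numerals, or any claim about RH — nothing in this file
mentions `ζ`, the critical strip or RH, and nothing here bears on the truth of RH.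

Source: A. Connes, C. Consani, *Weil positivity and trace formula, the archimedean place*, Selecta Math.
(N.S.) 27 (2021) 77 = arXiv:2006.13771 [bib `ConnesConsani2021`]: §4 p. 16 eq. (74)/(cosalphan)
(`∫_{−1}^{1} ψ_n(x)cos(2πxy)dx = λ(n)ψ_n(y)`), Prop. 4.5 (ii)–(iii) p. 17 ("the `ξ_n` form an orthonormal
basis of the range of `𝒫₁`" in `L²(ℝ)_ev`; Bessel against cut-off plane waves), Remark 4.6 (i) p. 18,
App. F (arXiv chunk p0035:L55: `η_n′(ρ) = −4π∫_0^1 sin(2πρx)ξ_n(x)x dx`), §5 p. 32 (`η_n = λ(n)ξ_n^{an}`).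
The identity itself is the `y`-derivative companion of Remark 4.6 (i)'s pointwise Parseval
`Σ λ(n)²ψ_n(y)² = ‖c_y‖²` (tree: `hasSum_sq_prolateEigen_mul_sq_of_xi_complete`, seat t12): it is
Parseval for the vector `s_y = ∂_y c_y`, whose coefficients are `⟨ξ_n|s_y⟩ = η̃_n′(y) = λ(n)(ψ_n^{an})′(y)`.

## What is here (theorems only: 0 definitions, 0 named facts; completeness = the tree THEOREM
`CC2021_sec4_xi_complete_holds`)

* the cut-off sine-moment wave `s_y := 1_{[−1,1]}(x)·(−2πx)sin(2πxy)` in `L²(ℝ)`: `memLp_cutoffSinWave`,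
  `norm_cutoffSinWave_sq_eq_integral` (`‖s_y‖² = ∫_{−1}^{1}(2πx)²sin²(2πxy)dx`), `cutoffSinWave_mem_evenPart`,
  `cutoffProj_cutoffSinWave`, **`inner_cutoffSinWave_prolateXi`** (`⟨s_y|ξ_n⟩ = η̃_n′(y)`, all real `y`),
  `deriv_cosTransform_prolateFun_eq` (`η̃_n′ = λ(n)(ψ_n^{an})′` on `ℝ`),
  `deriv_prolateFun_eq_deriv_prolateFunAn` (`ψ_n′ = (ψ_n^{an})′` on `(−1,1)`);
* Bessel (no completeness): `sum_sq_deriv_cosTransform_le`;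
* **PARSEVAL** (from `CC2021_sec4_xi_complete`, then unconditionally via `_holds`):
  `hasSum_sq_deriv_cosTransform[_of_xi_complete]` — `Σ_n η̃_n′(y)² = ‖s_y‖²` for EVERY real `y`;
  `hasSum_sq_prolateEigen_mul_sq_deriv_prolateFunAn[_of_xi_complete]` — `Σ_n λ(n)²(ψ_n^{an})′(y)² = ‖s_y‖²`
  for every real `y` (the form the (98)/(99) bookkeeping on `ρx ∈ [1,2]` uses);
  **`hasSum_sq_prolateEigen_mul_sq_deriv[_of_xi_complete]`** — `Σ_n λ(n)²ψ_n′(y)² = ‖s_y‖²` for `y ∈ (−1,1)`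
  (the statement asked for in R105 (1));
* the cosine companion for EVERY real `y` (t12's identity is stated for `y ∈ [−1,1]`):
  `hasSum_sq_cosTransform`, `hasSum_sq_prolateEigen_mul_sq_prolateFunAn` — `Σ_n λ(n)²ψ_n^{an}(y)² = ‖c_y‖²`;
* the closed form `norm_cutoffSinWave_sq` (`‖s_y‖² = 4π²/3 − 4π²(sin a/a + 2cos a/a² − 2sin a/a³)`, `a = 4πy`)
  and `hasSum_sq_prolateEigen_mul_sq_deriv_prolateFunAn_one` (`Σλ(n)²(ψ_n^{an})′(1)² = 4π²/3 − 1/2`);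
* (P3) the SECOND-DERIVATIVE companion against `w_y := 1_{[−1,1]}·(−(2πx)²)cos(2πxy)`:
  `inner_cutoffCosMomentWave_prolateXi` (`⟨w_y|ξ_n⟩ = η̃_n″(y)`), `hasSum_sq_deriv_deriv_cosTransform`,
  `hasSum_sq_prolateEigen_mul_sq_deriv_deriv_prolateFunAn` (all real `y`),
  **`hasSum_sq_prolateEigen_mul_sq_deriv_deriv`** (`Σ_n λ(n)²ψ_n″(y)² = ‖w_y‖²`, `y ∈ (−1,1)`);
* (P4) the INTEGRATED identities (Hilbert–Schmidt norms in the `L²((0,1])` model of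
  `ProlateTraceIdentities.lean`, kernels `2·(−2πx)sin(2πxy)` and `2·(−(2πx)²)cos(2πxy)`):
  **`hasSum_sq_prolateEigen_mul_integral_sq_deriv_prolateFunAn`** (`Σ_n λ(n)²‖(ψ_n^{an})′‖²_{L²(−1,1)} = 8π²/3 + 1/2`),
  **`hasSum_sq_prolateEigen_mul_integral_sq_deriv_deriv_prolateFunAn`** (`Σ_n λ(n)²‖(ψ_n^{an})″‖²_{L²(−1,1)} = 32π⁴/5 − 2π² + 3/4`).
These are items (P2)–(P4) of the (ii)-FULL fallback spec `cc/drafts/t7-K3-tail-ii-FULL.md` §1 (seat t7).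
-/

noncomputable section

open Real MeasureTheory Set Filter Complex
open scoped InnerProductSpace Topology

namespace Literature.NumberTheory.ConnesConsani2021

open Literature.NumberTheory.LFunctions

/-! ## The cut-off sine-moment wave `s_y = 1_{[−1,1]}·(−2πx) sin(2πxy)` in `L²(ℝ)` -/

/-- `|s_y| ≤ 2π`. [cite: ConnesConsani2021, App. F (arXiv chunk p0035:L53–L55: "|η_n′| ≤ 4π")] -/
private theorem norm_cutoffSinWave_le (y x : ℝ) :
    ‖(Icc (-1 : ℝ) 1).indicator
        (fun x : ℝ ↦ ((-(2 * π * x) * Real.sin (2 * π * x * y) : ℝ) : ℂ)) x‖ ≤ 2 * π := by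
  by_cases hx : x ∈ Icc (-1 : ℝ) 1
  · rw [indicator_of_mem hx, Complex.norm_real, Real.norm_eq_abs, abs_mul, abs_neg, abs_mul,
      abs_of_pos (by positivity : (0 : ℝ) < 2 * π)]
    have h1 : |x| ≤ 1 := abs_le.2 ⟨hx.1, hx.2⟩
    have h2 := Real.abs_sin_le_one (2 * π * x * y)
    calc 2 * π * |x| * |Real.sin (2 * π * x * y)| ≤ 2 * π * 1 * 1 := by gcongr
      _ = 2 * π := by ring
  · rw [indicator_of_notMem hx, norm_zero]; positivity

/-- `s_y` is integrable. [cite: ConnesConsani2021, App. F (arXiv chunk p0035:L55)] -/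
private theorem integrable_cutoffSinWave (y : ℝ) :
    Integrable ((Icc (-1 : ℝ) 1).indicator
      fun x : ℝ ↦ ((-(2 * π * x) * Real.sin (2 * π * x * y) : ℝ) : ℂ)) := by
  refine IntegrableOn.integrable_indicator ?_ measurableSet_Icc
  exact (by fun_prop : Continuous fun x : ℝ ↦
    ((-(2 * π * x) * Real.sin (2 * π * x * y) : ℝ) : ℂ)).integrableOn_Icc

/-- `s_y ∈ L²(ℝ)`. [cite: ConnesConsani2021, Prop. 4.5 (iii) proof §4 p. 17 (arXiv p0017:L26); App. F (p0035:L55)] -/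
theorem memLp_cutoffSinWave (y : ℝ) :
    MemLp ((Icc (-1 : ℝ) 1).indicator
      fun x : ℝ ↦ ((-(2 * π * x) * Real.sin (2 * π * x * y) : ℝ) : ℂ)) 2 (volume : Measure ℝ) :=
  Literature.Analysis.FluidPDE.FourierNS.memLp_two_of_bound (integrable_cutoffSinWave y)
    (norm_cutoffSinWave_le y)

/-- `‖s_y‖² = ∫_{−1}^{1} (2πx)² sin²(2πxy) dx`. [cite: ConnesConsani2021, Prop. 4.5 (iii) proof §4 p. 17 (arXiv p0017:L26); App. F (p0035:L55)] -/
theorem norm_cutoffSinWave_sq_eq_integral (y : ℝ) :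
    ‖(memLp_cutoffSinWave y).toLp _‖ ^ 2 =
      ∫ x in (-1 : ℝ)..1, (2 * π * x) ^ 2 * Real.sin (2 * π * x * y) ^ 2 := by
  rw [← inner_self_eq_norm_sq (𝕜 := ℂ) ((memLp_cutoffSinWave y).toLp _), L2.inner_def]
  have h1 : ∫ x : ℝ, ⟪((memLp_cutoffSinWave y).toLp _ : ℝ → ℂ) x,
      ((memLp_cutoffSinWave y).toLp _ : ℝ → ℂ) x⟫_ℂ =
      ∫ x : ℝ, (Icc (-1 : ℝ) 1).indicator
        (fun x ↦ (((2 * π * x) ^ 2 * Real.sin (2 * π * x * y) ^ 2 : ℝ) : ℂ)) x := by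
    refine integral_congr_ae ?_
    filter_upwards [MemLp.coeFn_toLp (memLp_cutoffSinWave y)] with x hx
    rw [hx, RCLike.inner_apply]
    by_cases hxI : x ∈ Icc (-1 : ℝ) 1
    · rw [indicator_of_mem hxI, indicator_of_mem hxI, Complex.conj_ofReal]; push_cast; ring
    · simp [indicator_of_notMem hxI]
  rw [h1, integral_indicator measurableSet_Icc, integral_complex_ofReal,
    integral_Icc_eq_integral_Ioc, ← intervalIntegral.integral_of_le (by norm_num : (-1 : ℝ) ≤ 1)]
  simp

/-- `s_y` is even (`(−2π(−x))sin(2π(−x)y) = (−2πx)sin(2πxy)`). [cite: ConnesConsani2021, Prop. 4.5 (iii) proof §4 p. 17 (arXiv p0017:L26)] -/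
theorem cutoffSinWave_mem_evenPart (y : ℝ) : (memLp_cutoffSinWave y).toLp _ ∈ evenPart := by
  rw [mem_evenPart_iff]
  have h := MemLp.coeFn_toLp (memLp_cutoffSinWave y)
  filter_upwards [h,
    (Measure.measurePreserving_neg (volume : Measure ℝ)).quasiMeasurePreserving.ae_eq_comp h]
    with x hx hx'
  simp only [Function.comp_apply] at hx'
  rw [hx', hx]
  by_cases hxI : x ∈ Icc (-1 : ℝ) 1
  · have hxI' : -x ∈ Icc (-1 : ℝ) 1 := ⟨by linarith [hxI.2], by linarith [hxI.1]⟩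
    rw [indicator_of_mem hxI, indicator_of_mem hxI']
    congr 1
    rw [show 2 * π * -x * y = -(2 * π * x * y) by ring, Real.sin_neg]
    ring
  · have hxI' : -x ∉ Icc (-1 : ℝ) 1 := fun h' => hxI ⟨by linarith [h'.2], by linarith [h'.1]⟩
    rw [indicator_of_notMem hxI, indicator_of_notMem hxI']

/-- `𝒫₁ s_y = s_y` (`s_y` is supported in `[−1,1]`). [cite: ConnesConsani2021, Prop. 4.5 (iii) proof §4 p. 17 (arXiv p0017:L26)] -/
theorem cutoffProj_cutoffSinWave (y : ℝ) :
    cutoffProj 1 ((memLp_cutoffSinWave y).toLp _) = (memLp_cutoffSinWave y).toLp _ := by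
  apply Lp.ext
  filter_upwards [cutoffProj_coeFn 1 ((memLp_cutoffSinWave y).toLp _),
    MemLp.coeFn_toLp (memLp_cutoffSinWave y)] with x h1 h2
  rw [h1]
  by_cases hx : x ∈ Icc (-1 : ℝ) 1
  · rw [indicator_of_mem hx]
  · rw [indicator_of_notMem hx, h2, indicator_of_notMem hx]

/-- **`⟨s_y|ξ_n⟩ = ∫_{−1}^{1} ψ_n(x)(−2πx)sin(2πxy) dx = η̃_n′(y)`** for every real `y` (the derivative of
the cosine transform under the integral sign, tree `hasDerivAt_cosTransform`).
[cite: ConnesConsani2021, App. F (arXiv chunk p0035:L55: "η_n′(ρ) = −4π∫_0^1 sin(2πρx)ξ_n(x)x dx"); §4 p. 16 eq. (74)] -/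
theorem inner_cutoffSinWave_prolateXi (y : ℝ) (n : ℕ) :
    ⟪(memLp_cutoffSinWave y).toLp _, prolateXi n⟫_ℂ =
      ((deriv (cosTransform (prolateFun n)) y : ℝ) : ℂ) := by
  rw [(hasDerivAt_cosTransform (isProlateFunction_prolateFun n).contDiffOn.continuousOn y).deriv,
    L2.inner_def]
  have h1 : ∫ x : ℝ, ⟪((memLp_cutoffSinWave y).toLp _ : ℝ → ℂ) x, (prolateXi n : ℝ → ℂ) x⟫_ℂ =
      ∫ x : ℝ, (Icc (-1 : ℝ) 1).indicator
        (fun x ↦ ((prolateFun n x * (-(2 * π * x) * Real.sin (2 * π * x * y)) : ℝ) : ℂ)) x := by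
    refine integral_congr_ae ?_
    filter_upwards [MemLp.coeFn_toLp (memLp_cutoffSinWave y), prolateXi_coeFn n] with x hx hξ
    rw [hx, hξ, RCLike.inner_apply]
    by_cases hxI : x ∈ Icc (-1 : ℝ) 1
    · rw [indicator_of_mem hxI, indicator_of_mem hxI, Complex.conj_ofReal, prolateXiFun]
      push_cast; ring
    · simp [indicator_of_notMem hxI, prolateXiFun, prolateFun_eq_zero_of_notMem hxI]
  rw [h1, integral_indicator measurableSet_Icc, integral_complex_ofReal,
    integral_Icc_eq_integral_Ioc, ← intervalIntegral.integral_of_le (by norm_num : (-1 : ℝ) ≤ 1)]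

/-- **`η̃_n′ = λ(n)·(ψ_n^{an})′` on all of `ℝ`** (from `η̃_n = λ(n)ψ_n^{an}`, the printed `η_n = λ(n)ξ_n^{an}`).
[cite: ConnesConsani2021, §5 p. 32, text before eq. (99) (arXiv chunk p0020:L69–L72)] -/
theorem deriv_cosTransform_prolateFun_eq (n : ℕ) (y : ℝ) :
    deriv (cosTransform (prolateFun n)) y = prolateEigen n * deriv (prolateFunAn n) y := by
  rw [deriv_prolateFunAn, mul_inv_cancel_left₀ (prolateEigen_ne_zero n)]

/-- `ψ_n′ = (ψ_n^{an})′` in the OPEN band `(−1,1)` (`ψ_n^{an} = ψ_n` on `[−1,1]`).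
[cite: ConnesConsani2021, §5 p. 32, text before eq. (99); §4 p. 16 eq. (cosalphan)] -/
theorem deriv_prolateFun_eq_deriv_prolateFunAn {n : ℕ} {y : ℝ} (hy : y ∈ Ioo (-1 : ℝ) 1) :
    deriv (prolateFun n) y = deriv (prolateFunAn n) y := by
  apply Filter.EventuallyEq.deriv_eq
  filter_upwards [Ioo_mem_nhds hy.1 hy.2] with x hx
  exact (prolateFunAn_eq_prolateFun (Ioo_subset_Icc_self hx)).symm

/-- In the open band, `η̃_n′(y) = λ(n)ψ_n′(y)` (the `y`-derivative of (74)/(cosalphan)).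
[cite: ConnesConsani2021, §4 p. 16 eq. (74)/(cosalphan) (arXiv p0016:L25–L28)] -/
theorem deriv_cosTransform_prolateFun_eq_of_mem_Ioo {n : ℕ} {y : ℝ} (hy : y ∈ Ioo (-1 : ℝ) 1) :
    deriv (cosTransform (prolateFun n)) y = prolateEigen n * deriv (prolateFun n) y := by
  rw [deriv_cosTransform_prolateFun_eq, deriv_prolateFun_eq_deriv_prolateFunAn hy]

/-! ## Bessel against `s_y` (no completeness needed) -/

/-- **Bessel against `s_y`**: for every real `y` and every finite set of indices,
`Σ_n η̃_n′(y)² = Σ_n |⟨ξ_n|s_y⟩|² ≤ ‖s_y‖²`. [cite: ConnesConsani2021, Prop. 4.5 (iii) proof §4 p. 17 (arXiv p0017:L26)] -/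
theorem sum_sq_deriv_cosTransform_le (y : ℝ) (s : Finset ℕ) :
    ∑ n ∈ s, deriv (cosTransform (prolateFun n)) y ^ 2 ≤ ‖(memLp_cutoffSinWave y).toLp _‖ ^ 2 := by
  have hB := CC2021_sec4_xi_orthonormal_holds.sum_inner_products_le
    ((memLp_cutoffSinWave y).toLp _) (s := s)
  refine le_trans (le_of_eq ?_) hB
  refine Finset.sum_congr rfl fun n _ ↦ ?_
  rw [norm_inner_symm, inner_cutoffSinWave_prolateXi, Complex.norm_real, Real.norm_eq_abs, sq_abs]

/-- Bessel, `λ(n)²(ψ_n^{an})′(y)²` form, every real `y`. [cite: ConnesConsani2021, Prop. 4.5 (iii) proof §4 p. 17; §5 p. 32] -/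
theorem sum_sq_prolateEigen_mul_sq_deriv_prolateFunAn_le (y : ℝ) (s : Finset ℕ) :
    ∑ n ∈ s, prolateEigen n ^ 2 * deriv (prolateFunAn n) y ^ 2 ≤
      ‖(memLp_cutoffSinWave y).toLp _‖ ^ 2 := by
  have h := sum_sq_deriv_cosTransform_le y s
  refine le_trans (le_of_eq (Finset.sum_congr rfl fun n _ ↦ ?_)) h
  rw [deriv_cosTransform_prolateFun_eq, mul_pow]

/-! ## Parseval against `s_y` from the completeness of the `ξ_n` -/

/-- **Derivative-Parseval, from completeness**: if the `ξ_n` form an orthonormal basis of `𝒫₁L²(ℝ)_ev`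
(`CC2021_sec4_xi_complete`), then for EVERY real `y`, `Σ_n η̃_n′(y)² = Σ_n |⟨ξ_n|s_y⟩|² = ‖s_y‖²`.
[cite: ConnesConsani2021, Remark 4.6 (i) §4 p. 18 (arXiv item Remark 26, p0018:L5–L15); Prop. 4.5 (ii)–(iii) p. 17; App. F (p0035:L55)] -/
theorem hasSum_sq_deriv_cosTransform_of_xi_complete (h : CC2021_sec4_xi_complete) (y : ℝ) :
    HasSum (fun n : ℕ ↦ deriv (cosTransform (prolateFun n)) y ^ 2)
      (‖(memLp_cutoffSinWave y).toLp _‖ ^ 2) := by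
  set c : Lp ℂ 2 (volume : Measure ℝ) := (memLp_cutoffSinWave y).toLp _ with hc
  have hs := hasSum_inner_smul_prolateXi_of_xi_complete h (cutoffSinWave_mem_evenPart y)
  rw [cutoffProj_cutoffSinWave] at hs
  -- pair the expansion `c = Σ ⟨ξ_n|c⟩ ξ_n` with `c`
  have h2 := hs.mapL (innerSL ℂ c)
  have hterm : ∀ n : ℕ, innerSL ℂ c (⟪prolateXi n, c⟫_ℂ • prolateXi n) =
      ((deriv (cosTransform (prolateFun n)) y ^ 2 : ℝ) : ℂ) := by
    intro n
    rw [innerSL_apply_apply, inner_smul_right, ← inner_conj_symm (prolateXi n) c, hc,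
      inner_cutoffSinWave_prolateXi, Complex.conj_ofReal]
    push_cast
    ring
  have e : (fun n : ℕ ↦ innerSL ℂ c (⟪prolateXi n, c⟫_ℂ • prolateXi n)) =
      fun n : ℕ ↦ ((deriv (cosTransform (prolateFun n)) y ^ 2 : ℝ) : ℂ) := funext hterm
  have h3 : HasSum (fun n : ℕ ↦ ((deriv (cosTransform (prolateFun n)) y ^ 2 : ℝ) : ℂ)) ⟪c, c⟫_ℂ := by
    rw [← e, ← innerSL_apply_apply (𝕜 := ℂ)]
    exact h2
  have h4 : ⟪c, c⟫_ℂ = ((‖c‖ ^ 2 : ℝ) : ℂ) := by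
    rw [inner_self_eq_norm_sq_to_K]; norm_cast
  rw [h4] at h3
  exact Complex.hasSum_ofReal.1 h3

/-- `Σ_n λ(n)²(ψ_n^{an})′(y)² = ‖s_y‖²` for EVERY real `y`, from completeness.
[cite: ConnesConsani2021, Remark 4.6 (i) §4 p. 18; §5 p. 32 (η_n = λ(n)ξ_n^{an}); App. F (p0035:L55)] -/
theorem hasSum_sq_prolateEigen_mul_sq_deriv_prolateFunAn_of_xi_complete (h : CC2021_sec4_xi_complete)
    (y : ℝ) :
    HasSum (fun n : ℕ ↦ prolateEigen n ^ 2 * deriv (prolateFunAn n) y ^ 2)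
      (‖(memLp_cutoffSinWave y).toLp _‖ ^ 2) := by
  have hs := hasSum_sq_deriv_cosTransform_of_xi_complete h y
  have e : (fun n : ℕ ↦ deriv (cosTransform (prolateFun n)) y ^ 2) =
      fun n : ℕ ↦ prolateEigen n ^ 2 * deriv (prolateFunAn n) y ^ 2 := by
    funext n; rw [deriv_cosTransform_prolateFun_eq, mul_pow]
  rwa [e] at hs

/-- **The statement of R105 (1)**: `Σ_n λ(n)²ψ_n′(y)² = ‖s_y‖²` for `y ∈ (−1,1)`, from completeness.
[cite: ConnesConsani2021, Remark 4.6 (i) §4 p. 18 (arXiv item Remark 26, p0018:L5–L15); §4 p. 16 eq. (74)/(cosalphan); App. F (p0035:L55)] -/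
theorem hasSum_sq_prolateEigen_mul_sq_deriv_of_xi_complete (h : CC2021_sec4_xi_complete) {y : ℝ}
    (hy : y ∈ Ioo (-1 : ℝ) 1) :
    HasSum (fun n : ℕ ↦ prolateEigen n ^ 2 * deriv (prolateFun n) y ^ 2)
      (‖(memLp_cutoffSinWave y).toLp _‖ ^ 2) := by
  have hs := hasSum_sq_prolateEigen_mul_sq_deriv_prolateFunAn_of_xi_complete h y
  have e : (fun n : ℕ ↦ prolateEigen n ^ 2 * deriv (prolateFunAn n) y ^ 2) =
      fun n : ℕ ↦ prolateEigen n ^ 2 * deriv (prolateFun n) y ^ 2 := by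
    funext n; rw [deriv_prolateFun_eq_deriv_prolateFunAn hy]
  rwa [e] at hs

/-! ## Unconditionally (completeness is the tree theorem `CC2021_sec4_xi_complete_holds`) -/

/-- **Derivative-Parseval**: `Σ_n η̃_n′(y)² = ‖s_y‖² = ∫_{−1}^{1}(2πx)²sin²(2πxy)dx` for every real `y`.
[cite: ConnesConsani2021, Remark 4.6 (i) §4 p. 18; Prop. 4.5 (ii)–(iii) p. 17; App. F (p0035:L55)] -/
theorem hasSum_sq_deriv_cosTransform (y : ℝ) :
    HasSum (fun n : ℕ ↦ deriv (cosTransform (prolateFun n)) y ^ 2)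
      (‖(memLp_cutoffSinWave y).toLp _‖ ^ 2) :=
  hasSum_sq_deriv_cosTransform_of_xi_complete CC2021_sec4_xi_complete_holds y

/-- **Derivative-Parseval**: `Σ_n λ(n)²(ψ_n^{an})′(y)² = ‖s_y‖²` for every real `y`.
[cite: ConnesConsani2021, Remark 4.6 (i) §4 p. 18; §5 p. 32; App. F (p0035:L55)] -/
theorem hasSum_sq_prolateEigen_mul_sq_deriv_prolateFunAn (y : ℝ) :
    HasSum (fun n : ℕ ↦ prolateEigen n ^ 2 * deriv (prolateFunAn n) y ^ 2)
      (‖(memLp_cutoffSinWave y).toLp _‖ ^ 2) :=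
  hasSum_sq_prolateEigen_mul_sq_deriv_prolateFunAn_of_xi_complete CC2021_sec4_xi_complete_holds y

/-- **Derivative-Parseval (R105 (1))**: `Σ_n λ(n)²ψ_n′(y)² = ‖s_y‖²` for `y ∈ (−1,1)`.
[cite: ConnesConsani2021, Remark 4.6 (i) §4 p. 18; §4 p. 16 eq. (74)/(cosalphan); App. F (p0035:L55)] -/
theorem hasSum_sq_prolateEigen_mul_sq_deriv {y : ℝ} (hy : y ∈ Ioo (-1 : ℝ) 1) :
    HasSum (fun n : ℕ ↦ prolateEigen n ^ 2 * deriv (prolateFun n) y ^ 2)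
      (‖(memLp_cutoffSinWave y).toLp _‖ ^ 2) :=
  hasSum_sq_prolateEigen_mul_sq_deriv_of_xi_complete CC2021_sec4_xi_complete_holds hy

/-- The same with the norm written out: `Σ_n λ(n)²ψ_n′(y)² = ∫_{−1}^{1}(2πx)²sin²(2πxy)dx`, `y ∈ (−1,1)`.
[cite: ConnesConsani2021, Remark 4.6 (i) §4 p. 18; App. F (p0035:L55)] -/
theorem hasSum_sq_prolateEigen_mul_sq_deriv_eq_integral {y : ℝ} (hy : y ∈ Ioo (-1 : ℝ) 1) :
    HasSum (fun n : ℕ ↦ prolateEigen n ^ 2 * deriv (prolateFun n) y ^ 2)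
      (∫ x in (-1 : ℝ)..1, (2 * π * x) ^ 2 * Real.sin (2 * π * x * y) ^ 2) := by
  rw [← norm_cutoffSinWave_sq_eq_integral]
  exact hasSum_sq_prolateEigen_mul_sq_deriv hy

/-- The tail beyond a finset, derivative form: `Σ_{n ∉ F} λ(n)²ψ_n′(y)² = ‖s_y‖² − Σ_{n∈F} λ(n)²ψ_n′(y)²`,
`y ∈ (−1,1)`. [cite: ConnesConsani2021, Remark 4.6 (i) §4 p. 18; App. F (p0035:L55)] -/
theorem hasSum_sq_prolateEigen_mul_sq_deriv_compl {y : ℝ} (hy : y ∈ Ioo (-1 : ℝ) 1) (F : Finset ℕ) :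
    HasSum (fun n : {n // n ∉ F} ↦ prolateEigen n ^ 2 * deriv (prolateFun n) y ^ 2)
      (‖(memLp_cutoffSinWave y).toLp _‖ ^ 2 - ∑ n ∈ F, prolateEigen n ^ 2 * deriv (prolateFun n) y ^ 2) := by
  refine (Finset.hasSum_compl_iff (f := fun n : ℕ ↦ prolateEigen n ^ 2 * deriv (prolateFun n) y ^ 2) F).2 ?_
  rw [sub_add_cancel]
  exact hasSum_sq_prolateEigen_mul_sq_deriv hy

/-! ## The cosine companion for every real `y` -/

/-- Parseval against `c_y` for EVERY real `y` (t12's `hasSum_sq_prolateEigen_mul_sq_of_xi_complete` is the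
case `y ∈ [−1,1]`): `Σ_n η̃_n(y)² = ‖c_y‖² = ∫_{−1}^{1}cos²(2πxy)dx`.
[cite: ConnesConsani2021, Remark 4.6 (i) §4 p. 18 (arXiv item Remark 26, p0018:L5–L15); Prop. 4.5 (iii) proof p. 17 (arXiv p0017:L26)] -/
theorem hasSum_sq_cosTransform_of_xi_complete (h : CC2021_sec4_xi_complete) (y : ℝ) :
    HasSum (fun n : ℕ ↦ cosTransform (prolateFun n) y ^ 2) (‖(memLp_cutoffCosWave y).toLp _‖ ^ 2) := by
  set c : Lp ℂ 2 (volume : Measure ℝ) := (memLp_cutoffCosWave y).toLp _ with hc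
  have hs := hasSum_inner_smul_prolateXi_of_xi_complete h (cutoffCosWave_mem_evenPart y)
  rw [cutoffProj_cutoffCosWave] at hs
  have h2 := hs.mapL (innerSL ℂ c)
  have hterm : ∀ n : ℕ, innerSL ℂ c (⟪prolateXi n, c⟫_ℂ • prolateXi n) =
      ((cosTransform (prolateFun n) y ^ 2 : ℝ) : ℂ) := by
    intro n
    rw [innerSL_apply_apply, inner_smul_right, ← inner_conj_symm (prolateXi n) c, hc,
      inner_cutoffCosWave_prolateXi, Complex.conj_ofReal]
    push_cast
    ring
  have e : (fun n : ℕ ↦ innerSL ℂ c (⟪prolateXi n, c⟫_ℂ • prolateXi n)) =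
      fun n : ℕ ↦ ((cosTransform (prolateFun n) y ^ 2 : ℝ) : ℂ) := funext hterm
  have h3 : HasSum (fun n : ℕ ↦ ((cosTransform (prolateFun n) y ^ 2 : ℝ) : ℂ)) ⟪c, c⟫_ℂ := by
    rw [← e, ← innerSL_apply_apply (𝕜 := ℂ)]
    exact h2
  have h4 : ⟪c, c⟫_ℂ = ((‖c‖ ^ 2 : ℝ) : ℂ) := by
    rw [inner_self_eq_norm_sq_to_K]; norm_cast
  rw [h4] at h3
  exact Complex.hasSum_ofReal.1 h3

/-- `Σ_n η̃_n(y)² = ‖c_y‖²` for every real `y`, unconditionally. [cite: ConnesConsani2021, Remark 4.6 (i) §4 p. 18; Prop. 4.5 (iii) proof p. 17] -/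
theorem hasSum_sq_cosTransform (y : ℝ) :
    HasSum (fun n : ℕ ↦ cosTransform (prolateFun n) y ^ 2) (‖(memLp_cutoffCosWave y).toLp _‖ ^ 2) :=
  hasSum_sq_cosTransform_of_xi_complete CC2021_sec4_xi_complete_holds y

/-- **`Σ_n λ(n)²ψ_n^{an}(y)² = ‖c_y‖²` for EVERY real `y`** (beyond the band via the analytic continuation
`ψ_n^{an}`; for `y ∈ [−1,1]` this is t12's identity, for `y ≠ 0` the value is `1 + cos(2πy)sin(2πy)/(2πy)`,
`norm_cutoffCosWave_sq`). [cite: ConnesConsani2021, Remark 4.6 (i) §4 p. 18; §5 p. 32 (η_n = λ(n)ξ_n^{an})] -/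
theorem hasSum_sq_prolateEigen_mul_sq_prolateFunAn (y : ℝ) :
    HasSum (fun n : ℕ ↦ prolateEigen n ^ 2 * prolateFunAn n y ^ 2) (‖(memLp_cutoffCosWave y).toLp _‖ ^ 2) := by
  have hs := hasSum_sq_cosTransform y
  have e : (fun n : ℕ ↦ cosTransform (prolateFun n) y ^ 2) =
      fun n : ℕ ↦ prolateEigen n ^ 2 * prolateFunAn n y ^ 2 := by
    funext n; rw [cosTransform_prolateFun_eq_mul_prolateFunAn, mul_pow]
  rwa [e] at hs

/-! ## The norm `‖s_y‖²` in closed form -/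

/-- `∫_{−1}^{1} x² cos(ax) dx = 2(sin a/a + 2cos a/a² − 2sin a/a³)` (`a ≠ 0`). [folklore] -/
private theorem integral_sq_mul_cos {a : ℝ} (ha : a ≠ 0) :
    ∫ x in (-1 : ℝ)..1, x ^ 2 * Real.cos (a * x) =
      2 * (Real.sin a / a + 2 * Real.cos a / a ^ 2 - 2 * Real.sin a / a ^ 3) := by
  have hF : ∀ x ∈ uIcc (-1 : ℝ) 1,
      HasDerivAt (fun x : ℝ ↦ x ^ 2 * Real.sin (a * x) / a + 2 * x * Real.cos (a * x) / a ^ 2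
        - 2 * Real.sin (a * x) / a ^ 3) (x ^ 2 * Real.cos (a * x)) x := by
    intro x _
    have hs : HasDerivAt (fun x : ℝ ↦ Real.sin (a * x)) (a * Real.cos (a * x)) x := by
      have := ((hasDerivAt_id x).const_mul a).sin
      simpa [mul_comm] using this
    have hc : HasDerivAt (fun x : ℝ ↦ Real.cos (a * x)) (-(a * Real.sin (a * x))) x := by
      have := ((hasDerivAt_id x).const_mul a).cos
      simpa [mul_comm] using this
    have h1 := ((hasDerivAt_pow 2 x).mul hs).div_const a
    have h2 := (((hasDerivAt_id x).const_mul 2).mul hc).div_const (a ^ 2)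
    have h3 := hs.const_mul 2 |>.div_const (a ^ 3)
    have h := (h1.add h2).sub h3
    have h' := h.congr_of_eventuallyEq (f₁ := fun x : ℝ ↦ x ^ 2 * Real.sin (a * x) / a
        + 2 * x * Real.cos (a * x) / a ^ 2 - 2 * Real.sin (a * x) / a ^ 3)
      (Eventually.of_forall fun z ↦ by simp only [Pi.add_apply, Pi.sub_apply, Pi.mul_apply, id_eq])
    refine h'.congr_deriv ?_
    norm_num [id_eq]
    field_simp
    ring
  have hint : IntervalIntegrable (fun x : ℝ ↦ x ^ 2 * Real.cos (a * x)) volume (-1) 1 :=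
    (by fun_prop : Continuous fun x : ℝ ↦ x ^ 2 * Real.cos (a * x)).intervalIntegrable _ _
  rw [intervalIntegral.integral_eq_sub_of_hasDerivAt hF hint]
  simp only [mul_neg, Real.sin_neg, Real.cos_neg, neg_one_sq, one_pow, mul_one]
  ring

/-- **`‖s_y‖²` in closed form**: for `y ≠ 0`, with `a = 4πy`,
`∫_{−1}^{1}(2πx)²sin²(2πxy)dx = 4π²/3 − 4π²(sin a/a + 2cos a/a² − 2 sin a/a³)`.
[cite: ConnesConsani2021, Prop. 4.5 (iii) proof §4 p. 17 (arXiv p0017:L26); App. F (p0035:L55)] -/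
theorem integral_two_pi_mul_sq_mul_sin_sq {y : ℝ} (hy : y ≠ 0) :
    ∫ x in (-1 : ℝ)..1, (2 * π * x) ^ 2 * Real.sin (2 * π * x * y) ^ 2 =
      4 * π ^ 2 / 3 - 4 * π ^ 2 * (Real.sin (4 * π * y) / (4 * π * y)
        + 2 * Real.cos (4 * π * y) / (4 * π * y) ^ 2 - 2 * Real.sin (4 * π * y) / (4 * π * y) ^ 3) := by
  have ha : 4 * π * y ≠ 0 := mul_ne_zero (by positivity) hy
  have e : (fun x : ℝ ↦ (2 * π * x) ^ 2 * Real.sin (2 * π * x * y) ^ 2) =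
      fun x : ℝ ↦ 2 * π ^ 2 * x ^ 2 - 2 * π ^ 2 * (x ^ 2 * Real.cos (4 * π * y * x)) := by
    funext x
    rw [Real.sin_sq_eq_half_sub, show 2 * (2 * π * x * y) = 4 * π * y * x by ring]
    ring
  rw [e, intervalIntegral.integral_sub (by apply Continuous.intervalIntegrable; fun_prop)
    (by apply Continuous.intervalIntegrable; fun_prop), intervalIntegral.integral_const_mul,
    intervalIntegral.integral_const_mul, integral_pow, integral_sq_mul_cos ha]
  norm_num
  ring

/-- `‖s_y‖²` evaluated, `y ≠ 0`. [cite: ConnesConsani2021, Prop. 4.5 (iii) proof §4 p. 17; App. F (p0035:L55)] -/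
theorem norm_cutoffSinWave_sq {y : ℝ} (hy : y ≠ 0) :
    ‖(memLp_cutoffSinWave y).toLp _‖ ^ 2 =
      4 * π ^ 2 / 3 - 4 * π ^ 2 * (Real.sin (4 * π * y) / (4 * π * y)
        + 2 * Real.cos (4 * π * y) / (4 * π * y) ^ 2 - 2 * Real.sin (4 * π * y) / (4 * π * y) ^ 3) := by
  rw [norm_cutoffSinWave_sq_eq_integral, integral_two_pi_mul_sq_mul_sin_sq hy]

/-- At the band edge: `‖s_1‖² = 4π²/3 − 1/2` (`sin 4π = 0`, `cos 4π = 1`), i.e.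
`Σ_n λ(n)²(ψ_n^{an})′(1)² = 4π²/3 − 1/2`. [cite: ConnesConsani2021, Remark 4.6 (i) §4 p. 18; App. F (p0035:L55)] -/
theorem hasSum_sq_prolateEigen_mul_sq_deriv_prolateFunAn_one :
    HasSum (fun n : ℕ ↦ prolateEigen n ^ 2 * deriv (prolateFunAn n) 1 ^ 2) (4 * π ^ 2 / 3 - 1 / 2) := by
  have h := hasSum_sq_prolateEigen_mul_sq_deriv_prolateFunAn 1
  rw [norm_cutoffSinWave_sq one_ne_zero, mul_one] at h
  have hc : Real.cos (4 * π) = 1 := by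
    rw [show (4 : ℝ) * π = 2 * π + 2 * π by ring, Real.cos_add_two_pi, Real.cos_two_pi]
  have hs : Real.sin (4 * π) = 0 := by
    rw [show (4 : ℝ) * π = 2 * π + 2 * π by ring, Real.sin_add_two_pi, Real.sin_two_pi]
  rw [hc, hs] at h
  have hπ : π ≠ 0 := Real.pi_ne_zero
  convert h using 1
  field_simp
  ring

/-! ## (P3) The second-derivative companion: `Σ_n λ(n)² ψ_n″(y)² = ‖w_y‖²`,
`w_y := 1_{[−1,1]}·(−(2πx)²)cos(2πxy)` (t7's fallback spec `cc/drafts/t7-K3-tail-ii-FULL.md` §1 (P3)) -/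

section SecondDerivative

/-- `ψ_n` is interval-integrable on `[−1,1]`. [cite: ConnesConsani2021, Prop. 4.5 (i) §4 p. 16 (arXiv p0016:L50)] -/
private theorem intervalIntegrable_prolateFun' (n : ℕ) :
    IntervalIntegrable (prolateFun n) volume (-1) 1 := by
  apply ContinuousOn.intervalIntegrable
  rw [uIcc_of_le (by norm_num : (-1 : ℝ) ≤ 1)]
  exact (isProlateFunction_prolateFun n).contDiffOn.continuousOn

/-- `|w_y| ≤ 4π²`. [cite: ConnesConsani2021, App. E p. 35 (arXiv chunk p0035:L16: "|η_n″| ≤ …")] -/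
private theorem norm_cutoffCosMomentWave_le (y x : ℝ) :
    ‖(Icc (-1 : ℝ) 1).indicator
        (fun x : ℝ ↦ ((-(2 * π * x) ^ 2 * Real.cos (2 * π * x * y) : ℝ) : ℂ)) x‖ ≤ 4 * π ^ 2 := by
  by_cases hx : x ∈ Icc (-1 : ℝ) 1
  · rw [indicator_of_mem hx, Complex.norm_real, Real.norm_eq_abs, abs_mul, abs_neg, abs_pow,
      abs_mul, abs_of_pos (by positivity : (0 : ℝ) < 2 * π)]
    have h1 : |x| ≤ 1 := abs_le.2 ⟨hx.1, hx.2⟩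
    have h0 : 0 ≤ |x| := abs_nonneg x
    have h2 := Real.abs_cos_le_one (2 * π * x * y)
    have h3 : 0 ≤ |Real.cos (2 * π * x * y)| := abs_nonneg _
    calc (2 * π * |x|) ^ 2 * |Real.cos (2 * π * x * y)| ≤ (2 * π * 1) ^ 2 * 1 := by gcongr
      _ = 4 * π ^ 2 := by ring
  · rw [indicator_of_notMem hx, norm_zero]; positivity

/-- `w_y` is integrable. [cite: ConnesConsani2021, App. E p. 35 (arXiv chunk p0035:L16)] -/
private theorem integrable_cutoffCosMomentWave (y : ℝ) :
    Integrable ((Icc (-1 : ℝ) 1).indicator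
      fun x : ℝ ↦ ((-(2 * π * x) ^ 2 * Real.cos (2 * π * x * y) : ℝ) : ℂ)) := by
  refine IntegrableOn.integrable_indicator ?_ measurableSet_Icc
  exact (by fun_prop : Continuous fun x : ℝ ↦
    ((-(2 * π * x) ^ 2 * Real.cos (2 * π * x * y) : ℝ) : ℂ)).integrableOn_Icc

/-- `w_y ∈ L²(ℝ)`. [cite: ConnesConsani2021, Prop. 4.5 (iii) proof §4 p. 17 (arXiv p0017:L26); App. E p. 35 (p0035:L16)] -/
theorem memLp_cutoffCosMomentWave (y : ℝ) :
    MemLp ((Icc (-1 : ℝ) 1).indicator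
      fun x : ℝ ↦ ((-(2 * π * x) ^ 2 * Real.cos (2 * π * x * y) : ℝ) : ℂ)) 2 (volume : Measure ℝ) :=
  Literature.Analysis.FluidPDE.FourierNS.memLp_two_of_bound (integrable_cutoffCosMomentWave y)
    (norm_cutoffCosMomentWave_le y)

/-- `‖w_y‖² = ∫_{−1}^{1} (2πx)⁴ cos²(2πxy) dx`. [cite: ConnesConsani2021, Prop. 4.5 (iii) proof §4 p. 17 (arXiv p0017:L26); App. E p. 35 (p0035:L16)] -/
theorem norm_cutoffCosMomentWave_sq_eq_integral (y : ℝ) :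
    ‖(memLp_cutoffCosMomentWave y).toLp _‖ ^ 2 =
      ∫ x in (-1 : ℝ)..1, (2 * π * x) ^ 4 * Real.cos (2 * π * x * y) ^ 2 := by
  rw [← inner_self_eq_norm_sq (𝕜 := ℂ) ((memLp_cutoffCosMomentWave y).toLp _), L2.inner_def]
  have h1 : ∫ x : ℝ, ⟪((memLp_cutoffCosMomentWave y).toLp _ : ℝ → ℂ) x,
      ((memLp_cutoffCosMomentWave y).toLp _ : ℝ → ℂ) x⟫_ℂ =
      ∫ x : ℝ, (Icc (-1 : ℝ) 1).indicator
        (fun x ↦ (((2 * π * x) ^ 4 * Real.cos (2 * π * x * y) ^ 2 : ℝ) : ℂ)) x := by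
    refine integral_congr_ae ?_
    filter_upwards [MemLp.coeFn_toLp (memLp_cutoffCosMomentWave y)] with x hx
    rw [hx, RCLike.inner_apply]
    by_cases hxI : x ∈ Icc (-1 : ℝ) 1
    · rw [indicator_of_mem hxI, indicator_of_mem hxI, Complex.conj_ofReal]; push_cast; ring
    · simp [indicator_of_notMem hxI]
  rw [h1, integral_indicator measurableSet_Icc, integral_complex_ofReal,
    integral_Icc_eq_integral_Ioc, ← intervalIntegral.integral_of_le (by norm_num : (-1 : ℝ) ≤ 1)]
  simp

/-- `w_y` is even. [cite: ConnesConsani2021, Prop. 4.5 (iii) proof §4 p. 17 (arXiv p0017:L26)] -/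
theorem cutoffCosMomentWave_mem_evenPart (y : ℝ) : (memLp_cutoffCosMomentWave y).toLp _ ∈ evenPart := by
  rw [mem_evenPart_iff]
  have h := MemLp.coeFn_toLp (memLp_cutoffCosMomentWave y)
  filter_upwards [h,
    (Measure.measurePreserving_neg (volume : Measure ℝ)).quasiMeasurePreserving.ae_eq_comp h]
    with x hx hx'
  simp only [Function.comp_apply] at hx'
  rw [hx', hx]
  by_cases hxI : x ∈ Icc (-1 : ℝ) 1
  · have hxI' : -x ∈ Icc (-1 : ℝ) 1 := ⟨by linarith [hxI.2], by linarith [hxI.1]⟩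
    rw [indicator_of_mem hxI, indicator_of_mem hxI']
    congr 1
    rw [show 2 * π * -x * y = -(2 * π * x * y) by ring, Real.cos_neg]
    ring
  · have hxI' : -x ∉ Icc (-1 : ℝ) 1 := fun h' => hxI ⟨by linarith [h'.2], by linarith [h'.1]⟩
    rw [indicator_of_notMem hxI, indicator_of_notMem hxI']

/-- `𝒫₁ w_y = w_y`. [cite: ConnesConsani2021, Prop. 4.5 (iii) proof §4 p. 17 (arXiv p0017:L26)] -/
theorem cutoffProj_cutoffCosMomentWave (y : ℝ) :
    cutoffProj 1 ((memLp_cutoffCosMomentWave y).toLp _) = (memLp_cutoffCosMomentWave y).toLp _ := by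
  apply Lp.ext
  filter_upwards [cutoffProj_coeFn 1 ((memLp_cutoffCosMomentWave y).toLp _),
    MemLp.coeFn_toLp (memLp_cutoffCosMomentWave y)] with x h1 h2
  rw [h1]
  by_cases hx : x ∈ Icc (-1 : ℝ) 1
  · rw [indicator_of_mem hx]
  · rw [indicator_of_notMem hx, h2, indicator_of_notMem hx]

/-- **`⟨w_y|ξ_n⟩ = ∫_{−1}^{1} ψ_n(x)(−(2πx)²)cos(2πxy) dx = η̃_n″(y)`** for every real `y` (tree
`deriv_deriv_cosTransform`). [cite: ConnesConsani2021, App. E p. 35 (arXiv chunk p0035:L16, L55); §4 p. 16 eq. (74)] -/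
theorem inner_cutoffCosMomentWave_prolateXi (y : ℝ) (n : ℕ) :
    ⟪(memLp_cutoffCosMomentWave y).toLp _, prolateXi n⟫_ℂ =
      ((deriv (deriv (cosTransform (prolateFun n))) y : ℝ) : ℂ) := by
  rw [congrFun (deriv_deriv_cosTransform (intervalIntegrable_prolateFun' n)) y, L2.inner_def]
  have h1 : ∫ x : ℝ, ⟪((memLp_cutoffCosMomentWave y).toLp _ : ℝ → ℂ) x, (prolateXi n : ℝ → ℂ) x⟫_ℂ =
      ∫ x : ℝ, (Icc (-1 : ℝ) 1).indicator
        (fun x ↦ ((prolateFun n x * (-(2 * π * x) ^ 2 * Real.cos (2 * π * x * y)) : ℝ) : ℂ)) x := by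
    refine integral_congr_ae ?_
    filter_upwards [MemLp.coeFn_toLp (memLp_cutoffCosMomentWave y), prolateXi_coeFn n] with x hx hξ
    rw [hx, hξ, RCLike.inner_apply]
    by_cases hxI : x ∈ Icc (-1 : ℝ) 1
    · rw [indicator_of_mem hxI, indicator_of_mem hxI, Complex.conj_ofReal, prolateXiFun]
      push_cast; ring
    · simp [indicator_of_notMem hxI, prolateXiFun, prolateFun_eq_zero_of_notMem hxI]
  rw [h1, integral_indicator measurableSet_Icc, integral_complex_ofReal,
    integral_Icc_eq_integral_Ioc, ← intervalIntegral.integral_of_le (by norm_num : (-1 : ℝ) ≤ 1)]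

/-- `η̃_n″ = λ(n)·(ψ_n^{an})″` on all of `ℝ`. [cite: ConnesConsani2021, §5 p. 32, text before eq. (99) (arXiv chunk p0020:L69–L72)] -/
theorem deriv_deriv_cosTransform_prolateFun_eq (n : ℕ) (y : ℝ) :
    deriv (deriv (cosTransform (prolateFun n))) y =
      prolateEigen n * deriv (deriv (prolateFunAn n)) y := by
  rw [deriv_deriv_prolateFunAn, mul_inv_cancel_left₀ (prolateEigen_ne_zero n)]

/-- `ψ_n″ = (ψ_n^{an})″` in the open band `(−1,1)`. [cite: ConnesConsani2021, §5 p. 32, text before eq. (99); §4 p. 16 eq. (cosalphan)] -/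
theorem deriv_deriv_prolateFun_eq_of_mem_Ioo {n : ℕ} {y : ℝ} (hy : y ∈ Ioo (-1 : ℝ) 1) :
    deriv (deriv (prolateFun n)) y = deriv (deriv (prolateFunAn n)) y := by
  have h : prolateFun n =ᶠ[𝓝 y] prolateFunAn n := by
    filter_upwards [Ioo_mem_nhds hy.1 hy.2] with x hx
    exact (prolateFunAn_eq_prolateFun (Ioo_subset_Icc_self hx)).symm
  exact h.deriv.deriv_eq

/-- Bessel against `w_y` (no completeness): `Σ_{n∈s} η̃_n″(y)² ≤ ‖w_y‖²`. [cite: ConnesConsani2021, Prop. 4.5 (iii) proof §4 p. 17 (arXiv p0017:L26)] -/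
theorem sum_sq_deriv_deriv_cosTransform_le (y : ℝ) (s : Finset ℕ) :
    ∑ n ∈ s, deriv (deriv (cosTransform (prolateFun n))) y ^ 2 ≤
      ‖(memLp_cutoffCosMomentWave y).toLp _‖ ^ 2 := by
  have hB := CC2021_sec4_xi_orthonormal_holds.sum_inner_products_le
    ((memLp_cutoffCosMomentWave y).toLp _) (s := s)
  refine le_trans (le_of_eq ?_) hB
  refine Finset.sum_congr rfl fun n _ ↦ ?_
  rw [norm_inner_symm, inner_cutoffCosMomentWave_prolateXi, Complex.norm_real, Real.norm_eq_abs, sq_abs]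

/-- **Second-derivative Parseval, from completeness**: `Σ_n η̃_n″(y)² = ‖w_y‖²` for EVERY real `y`.
[cite: ConnesConsani2021, Remark 4.6 (i) §4 p. 18 (arXiv item Remark 26, p0018:L5–L15); Prop. 4.5 (ii)–(iii) p. 17; App. E p. 35 (p0035:L16)] -/
theorem hasSum_sq_deriv_deriv_cosTransform_of_xi_complete (h : CC2021_sec4_xi_complete) (y : ℝ) :
    HasSum (fun n : ℕ ↦ deriv (deriv (cosTransform (prolateFun n))) y ^ 2)
      (‖(memLp_cutoffCosMomentWave y).toLp _‖ ^ 2) := by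
  set c : Lp ℂ 2 (volume : Measure ℝ) := (memLp_cutoffCosMomentWave y).toLp _ with hc
  have hs := hasSum_inner_smul_prolateXi_of_xi_complete h (cutoffCosMomentWave_mem_evenPart y)
  rw [cutoffProj_cutoffCosMomentWave] at hs
  have h2 := hs.mapL (innerSL ℂ c)
  have hterm : ∀ n : ℕ, innerSL ℂ c (⟪prolateXi n, c⟫_ℂ • prolateXi n) =
      ((deriv (deriv (cosTransform (prolateFun n))) y ^ 2 : ℝ) : ℂ) := by
    intro n
    rw [innerSL_apply_apply, inner_smul_right, ← inner_conj_symm (prolateXi n) c, hc,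
      inner_cutoffCosMomentWave_prolateXi, Complex.conj_ofReal]
    push_cast
    ring
  have e : (fun n : ℕ ↦ innerSL ℂ c (⟪prolateXi n, c⟫_ℂ • prolateXi n)) =
      fun n : ℕ ↦ ((deriv (deriv (cosTransform (prolateFun n))) y ^ 2 : ℝ) : ℂ) := funext hterm
  have h3 : HasSum (fun n : ℕ ↦ ((deriv (deriv (cosTransform (prolateFun n))) y ^ 2 : ℝ) : ℂ))
      ⟪c, c⟫_ℂ := by
    rw [← e, ← innerSL_apply_apply (𝕜 := ℂ)]
    exact h2
  have h4 : ⟪c, c⟫_ℂ = ((‖c‖ ^ 2 : ℝ) : ℂ) := by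
    rw [inner_self_eq_norm_sq_to_K]; norm_cast
  rw [h4] at h3
  exact Complex.hasSum_ofReal.1 h3

/-- `Σ_n η̃_n″(y)² = ‖w_y‖² = ∫_{−1}^{1}(2πx)⁴cos²(2πxy)dx` for every real `y`, unconditionally.
[cite: ConnesConsani2021, Remark 4.6 (i) §4 p. 18; App. E p. 35 (p0035:L16)] -/
theorem hasSum_sq_deriv_deriv_cosTransform (y : ℝ) :
    HasSum (fun n : ℕ ↦ deriv (deriv (cosTransform (prolateFun n))) y ^ 2)
      (‖(memLp_cutoffCosMomentWave y).toLp _‖ ^ 2) :=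
  hasSum_sq_deriv_deriv_cosTransform_of_xi_complete CC2021_sec4_xi_complete_holds y

/-- **(P3), all real `y`**: `Σ_n λ(n)²(ψ_n^{an})″(y)² = ‖w_y‖²`. [cite: ConnesConsani2021, Remark 4.6 (i) §4 p. 18; §5 p. 32 (η_n = λ(n)ξ_n^{an}); App. E p. 35 (p0035:L16)] -/
theorem hasSum_sq_prolateEigen_mul_sq_deriv_deriv_prolateFunAn (y : ℝ) :
    HasSum (fun n : ℕ ↦ prolateEigen n ^ 2 * deriv (deriv (prolateFunAn n)) y ^ 2)
      (‖(memLp_cutoffCosMomentWave y).toLp _‖ ^ 2) := by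
  have hs := hasSum_sq_deriv_deriv_cosTransform y
  have e : (fun n : ℕ ↦ deriv (deriv (cosTransform (prolateFun n))) y ^ 2) =
      fun n : ℕ ↦ prolateEigen n ^ 2 * deriv (deriv (prolateFunAn n)) y ^ 2 := by
    funext n; rw [deriv_deriv_cosTransform_prolateFun_eq, mul_pow]
  rwa [e] at hs

/-- **(P3)**: `Σ_n λ(n)²ψ_n″(y)² = ‖w_y‖²` for `y ∈ (−1,1)`. [cite: ConnesConsani2021, Remark 4.6 (i) §4 p. 18; §4 p. 16 eq. (74)/(cosalphan); App. E p. 35 (p0035:L16)] -/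
theorem hasSum_sq_prolateEigen_mul_sq_deriv_deriv {y : ℝ} (hy : y ∈ Ioo (-1 : ℝ) 1) :
    HasSum (fun n : ℕ ↦ prolateEigen n ^ 2 * deriv (deriv (prolateFun n)) y ^ 2)
      (‖(memLp_cutoffCosMomentWave y).toLp _‖ ^ 2) := by
  have hs := hasSum_sq_prolateEigen_mul_sq_deriv_deriv_prolateFunAn y
  have e : (fun n : ℕ ↦ prolateEigen n ^ 2 * deriv (deriv (prolateFunAn n)) y ^ 2) =
      fun n : ℕ ↦ prolateEigen n ^ 2 * deriv (deriv (prolateFun n)) y ^ 2 := by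
    funext n; rw [deriv_deriv_prolateFun_eq_of_mem_Ioo hy]
  rwa [e] at hs

/-- (P3) with the norm written out: `Σ_n λ(n)²ψ_n″(y)² = ∫_{−1}^{1}(2πx)⁴cos²(2πxy)dx`, `y ∈ (−1,1)`.
[cite: ConnesConsani2021, Remark 4.6 (i) §4 p. 18; App. E p. 35 (p0035:L16)] -/
theorem hasSum_sq_prolateEigen_mul_sq_deriv_deriv_eq_integral {y : ℝ} (hy : y ∈ Ioo (-1 : ℝ) 1) :
    HasSum (fun n : ℕ ↦ prolateEigen n ^ 2 * deriv (deriv (prolateFun n)) y ^ 2)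
      (∫ x in (-1 : ℝ)..1, (2 * π * x) ^ 4 * Real.cos (2 * π * x * y) ^ 2) := by
  rw [← norm_cutoffCosMomentWave_sq_eq_integral]
  exact hasSum_sq_prolateEigen_mul_sq_deriv_deriv hy

end SecondDerivative

/-! ## (P4′) The integrated derivative-Parseval identity
`Σ_n λ(n)² ‖(ψ_n^{an})′‖²_{L²(−1,1)} = ∫_{−1}^{1}‖s_y‖² dy = 8π²/3 + 1/2`

Hilbert–Schmidt norm of the integral operator on `L²((0,1])` with kernel `k(y,x) = 2·(−2πx)sin(2πxy)`
in the Hilbert basis `e_n = √2ψ_n|_{(0,1]}` (the `TraceModel` of `ProlateTraceIdentities.lean`: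
`(T_k e_n)(y) = √2 η̃_n′(y) = √2λ(n)(ψ_n^{an})′(y)`), the tree's Hilbert–Schmidt identity
`hasSum_integral_norm_sq_integral_kernel_mul` [Bump 1997, Thm. 2.3.2], and the double integral
`∫_0^1∫_0^1 16π²x²sin²(2πxy) dy dx = ∫_0^1 (8π²x² − 2πx sin 4πx) dx = 8π²/3 + 1/2` (Fubini in the
regular order).  Regularity/parity of `(ψ_n^{an})′`, `(ψ_n^{an})″`: tree `ProlateEigenvalueVirial.lean`
(`continuous_deriv_prolateFunAn`, `deriv_prolateFunAn_neg`, `continuous_deriv_deriv_prolateFunAn`). -/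

section Integrated

/-- Folding an even integrand over `[−1,1]`: `∫_{−1}^{1} f = 2∫_0^1 f`. [folklore] -/
private theorem intervalIntegral_eq_two_mul_of_even {f : ℝ → ℝ} (hf : ∀ x, f (-x) = f x)
    (h1 : IntervalIntegrable f volume (-1) 0) (h2 : IntervalIntegrable f volume 0 1) :
    ∫ x in (-1 : ℝ)..1, f x = 2 * ∫ x in (0 : ℝ)..1, f x := by
  rw [← intervalIntegral.integral_add_adjacent_intervals h1 h2, two_mul]
  congr 1
  have h := intervalIntegral.integral_comp_neg (a := (0 : ℝ)) (b := 1) f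
  rw [neg_zero] at h
  rw [← h]
  exact intervalIntegral.integral_congr fun x _ ↦ hf x

/-- `∫_0^1 sin²(2πx·y) dy = 1/2 − sin(4πx)/(8πx)` for `x ≠ 0`. [folklore] -/
private theorem integral_sin_sq_two_pi_mul {x : ℝ} (hx : x ≠ 0) :
    ∫ y in (0 : ℝ)..1, Real.sin (2 * π * x * y) ^ 2 = 1 / 2 - Real.sin (4 * π * x) / (8 * π * x) := by
  have hc : 2 * π * x ≠ 0 := by positivity
  have h := intervalIntegral.integral_comp_mul_left (fun u ↦ Real.sin u ^ 2) hc (a := 0) (b := 1)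
  rw [h, integral_sin_sq, smul_eq_mul, mul_zero, mul_one, Real.sin_zero, zero_mul,
    show 4 * π * x = 2 * (2 * π * x) by ring, Real.sin_two_mul]
  field_simp
  ring

/-- `∫_0^1 (8π²x² − 2πx sin 4πx) dx = 8π²/3 + 1/2`. [folklore] -/
private theorem integral_inner_closed_form :
    ∫ x in (0 : ℝ)..1, (8 * π ^ 2 * x ^ 2 - 2 * π * x * Real.sin (4 * π * x)) = 8 * π ^ 2 / 3 + 1 / 2 := by
  have hπ : π ≠ 0 := Real.pi_ne_zero
  have hF : ∀ x ∈ uIcc (0 : ℝ) 1,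
      HasDerivAt (fun x : ℝ ↦ 8 * π ^ 2 * x ^ 3 / 3 + x * Real.cos (4 * π * x) / 2
        - Real.sin (4 * π * x) / (8 * π)) (8 * π ^ 2 * x ^ 2 - 2 * π * x * Real.sin (4 * π * x)) x := by
    intro x _
    have hs : HasDerivAt (fun x : ℝ ↦ Real.sin (4 * π * x)) (4 * π * Real.cos (4 * π * x)) x := by
      have := ((hasDerivAt_id x).const_mul (4 * π)).sin
      simpa [mul_comm] using this
    have hc : HasDerivAt (fun x : ℝ ↦ Real.cos (4 * π * x)) (-(4 * π * Real.sin (4 * π * x))) x := by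
      have := ((hasDerivAt_id x).const_mul (4 * π)).cos
      simpa [mul_comm] using this
    have h1 := ((hasDerivAt_pow 3 x).const_mul (8 * π ^ 2)).div_const 3
    have h2 := ((hasDerivAt_id x).mul hc).div_const 2
    have h3 := hs.div_const (8 * π)
    have h := (h1.add h2).sub h3
    have h' := h.congr_of_eventuallyEq (f₁ := fun x : ℝ ↦ 8 * π ^ 2 * x ^ 3 / 3
        + x * Real.cos (4 * π * x) / 2 - Real.sin (4 * π * x) / (8 * π))
      (Eventually.of_forall fun z ↦ by simp only [Pi.add_apply, Pi.sub_apply, Pi.mul_apply, id_eq])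
    refine h'.congr_deriv ?_
    norm_num [id_eq]
    field_simp
    ring
  have hint : IntervalIntegrable (fun x : ℝ ↦ 8 * π ^ 2 * x ^ 2 - 2 * π * x * Real.sin (4 * π * x))
      volume 0 1 :=
    (by fun_prop : Continuous fun x : ℝ ↦
      8 * π ^ 2 * x ^ 2 - 2 * π * x * Real.sin (4 * π * x)).intervalIntegrable _ _
  rw [intervalIntegral.integral_eq_sub_of_hasDerivAt hF hint]
  have hc : Real.cos (4 * π) = 1 := by
    rw [show (4 : ℝ) * π = 2 * π + 2 * π by ring, Real.cos_add_two_pi, Real.cos_two_pi]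
  have hs : Real.sin (4 * π) = 0 := by
    rw [show (4 : ℝ) * π = 2 * π + 2 * π by ring, Real.sin_add_two_pi, Real.sin_two_pi]
  simp only [mul_one, one_pow, hc, mul_zero, Real.sin_zero, Real.cos_zero, zero_div]
  rw [hs]
  ring

/-- `∫_0^1 ψ_n(x)(−2πx)sin(2πxy) dx = ½ η̃_n′(y)` (evenness fold of `deriv_cosTransform`). [cite: ConnesConsani2021, App. F (arXiv chunk p0035:L55)] -/
private theorem integral_half_eq_half_deriv_cosTransform (n : ℕ) (y : ℝ) :
    ∫ x in (0 : ℝ)..1, prolateFun n x * (-(2 * π * x) * Real.sin (2 * π * x * y)) =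
      1 / 2 * deriv (cosTransform (prolateFun n)) y := by
  have hψc : ContinuousOn (prolateFun n) (Icc (-1 : ℝ) 1) :=
    (isProlateFunction_prolateFun n).contDiffOn.continuousOn
  have hcont : ContinuousOn (fun x ↦ prolateFun n x * (-(2 * π * x) * Real.sin (2 * π * x * y)))
      (Icc (-1 : ℝ) 1) :=
    hψc.mul (by fun_prop : Continuous fun x : ℝ ↦ -(2 * π * x) * Real.sin (2 * π * x * y)).continuousOn
  have h1 : IntervalIntegrable (fun x ↦ prolateFun n x * (-(2 * π * x) * Real.sin (2 * π * x * y)))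
      volume (-1) 0 := by
    apply ContinuousOn.intervalIntegrable
    rw [uIcc_of_le (by norm_num : (-1 : ℝ) ≤ 0)]
    exact hcont.mono (Icc_subset_Icc le_rfl zero_le_one)
  have h2 : IntervalIntegrable (fun x ↦ prolateFun n x * (-(2 * π * x) * Real.sin (2 * π * x * y)))
      volume 0 1 := by
    apply ContinuousOn.intervalIntegrable
    rw [uIcc_of_le (by norm_num : (0 : ℝ) ≤ 1)]
    exact hcont.mono (Icc_subset_Icc (by norm_num) le_rfl)
  rw [congrFun (deriv_cosTransform (intervalIntegrable_prolateFun' n)) y,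
    intervalIntegral_eq_two_mul_of_even (f := fun x ↦ prolateFun n x *
      (-(2 * π * x) * Real.sin (2 * π * x * y))) (fun x ↦ ?_) h1 h2]
  · ring
  · simp only [prolateFun_neg]
    rw [show 2 * π * -x * y = -(2 * π * x * y) by ring, Real.sin_neg]
    ring

/-- `∫_{−1}^{1} ((ψ_n^{an})′)² = 2∫_0^1 ((ψ_n^{an})′)²`. [cite: ConnesConsani2021, §4 p. 16 (even prolate functions); §5 p. 32] -/
private theorem integral_sq_deriv_prolateFunAn_eq_two_mul (n : ℕ) :
    ∫ y in (-1 : ℝ)..1, deriv (prolateFunAn n) y ^ 2 = 2 * ∫ y in (0 : ℝ)..1, deriv (prolateFunAn n) y ^ 2 := by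
  have hc : Continuous fun y ↦ deriv (prolateFunAn n) y ^ 2 := (continuous_deriv_prolateFunAn n).pow 2
  exact intervalIntegral_eq_two_mul_of_even (f := fun y ↦ deriv (prolateFunAn n) y ^ 2)
    (fun y ↦ by simp only [deriv_prolateFunAn_neg, neg_sq]) (hc.intervalIntegrable _ _)
    (hc.intervalIntegrable _ _)

/-- **(P4′) Integrated derivative-Parseval**: `Σ_n λ(n)² ∫_{−1}^{1}(ψ_n^{an})′(y)² dy = 8π²/3 + 1/2`
(`= ∫_{−1}^{1}‖s_y‖²dy = ∫∫_{[−1,1]²}(2πx)²sin²(2πxy)`; the Hilbert–Schmidt norm of the kernel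
`−2πx·sin(2πxy)`, which kills odd inputs, in the complete even basis `(ψ_n)`).
[cite: ConnesConsani2021, Remark 4.6 (i) §4 p. 18 (arXiv item Remark 26: the trace identity `Σλ(n)² = δ(1)`, same road); Prop. 4.5 (ii) p. 17; §5 p. 32; Bump1997, Ch. 2 §2.3 Thm. 2.3.2] -/
theorem hasSum_sq_prolateEigen_mul_integral_sq_deriv_prolateFunAn :
    HasSum (fun n : ℕ ↦ prolateEigen n ^ 2 * ∫ y in (-1 : ℝ)..1, deriv (prolateFunAn n) y ^ 2)
      (8 * π ^ 2 / 3 + 1 / 2) := by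
  haveI : IsFiniteMeasure ((volume : Measure ℝ).restrict (Ioc (0 : ℝ) 1)) :=
    isFiniteMeasure_restrict.2 measure_Ioc_lt_top.ne
  set b : HilbertBasis ℕ ℂ (Lp ℂ 2 ((volume : Measure ℝ).restrict (Ioc (0 : ℝ) 1))) :=
    HilbertBasis.mkOfOrthogonalEqBot orthonormal_toLp_sqrt_two_mul_prolateXiFun
      (orthogonal_span_toLp_sqrt_two_mul_prolateXiFun_eq_bot CC2021_sec4_xi_complete_holds) with hbdef
  have hb : ∀ n : ℕ, (b n : Lp ℂ 2 ((volume : Measure ℝ).restrict (Ioc (0 : ℝ) 1)))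
      = (memLp_sqrt_two_mul_prolateXiFun_restrict n).toLp _ := fun n ↦ by
    rw [hbdef, HilbertBasis.coe_mkOfOrthogonalEqBot]
  -- the kernel, clamped in `x` outside `[−1,1]` so that it is globally bounded
  set K : ℝ → ℝ → ℂ := fun y x ↦
    ((2 * (-(2 * π * max (-1) (min x 1)) * Real.sin (2 * π * x * y)) : ℝ) : ℂ) with hKdef
  have hclamp : ∀ x ∈ Icc (-1 : ℝ) 1, max (-1) (min x 1) = x := fun x hx ↦ by
    rw [min_eq_left hx.2, max_eq_right hx.1]
  have hK : StronglyMeasurable (Function.uncurry K) := by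
    apply Continuous.stronglyMeasurable
    simp only [hKdef, Function.uncurry_def]
    fun_prop
  have hC : ∀ y x, ‖K y x‖ ≤ 4 * π := fun y x ↦ by
    simp only [hKdef, Complex.norm_real, Real.norm_eq_abs]
    have h1 : |max (-1) (min x 1)| ≤ 1 :=
      abs_le.2 ⟨le_max_left _ _, max_le (by norm_num) (min_le_right _ _)⟩
    have h2 := Real.abs_sin_le_one (2 * π * x * y)
    rw [abs_mul, abs_mul, abs_neg, abs_mul, abs_of_pos (by positivity : (0 : ℝ) < 2 * π), abs_two]
    calc 2 * (2 * π * |max (-1) (min x 1)| * |Real.sin (2 * π * x * y)|) ≤ 2 * (2 * π * 1 * 1) := by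
          gcongr
      _ = 4 * π := by ring
  have hs := Literature.Analysis.OperatorTheory.hasSum_integral_norm_sq_integral_kernel_mul hK hC b
  -- `T_k e_n = √2 η̃_n′`
  have hinner : ∀ (n : ℕ) (y : ℝ),
      ∫ x, K y x * b n x ∂((volume : Measure ℝ).restrict (Ioc (0 : ℝ) 1)) =
        ((Real.sqrt 2 * deriv (cosTransform (prolateFun n)) y : ℝ) : ℂ) := by
    intro n y
    have e1 : ∫ x, K y x * b n x ∂((volume : Measure ℝ).restrict (Ioc (0 : ℝ) 1)) =
        ∫ x in Ioc (0 : ℝ) 1, (((2 * Real.sqrt 2) *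
          (prolateFun n x * (-(2 * π * x) * Real.sin (2 * π * x * y))) : ℝ) : ℂ) := by
      refine integral_congr_ae ?_
      rw [hb n]
      filter_upwards [(memLp_sqrt_two_mul_prolateXiFun_restrict n).coeFn_toLp,
        ae_restrict_mem measurableSet_Ioc] with x hx hxI
      rw [hx]
      simp only [hKdef, prolateXiFun, hclamp x ⟨by linarith [hxI.1], hxI.2⟩]
      push_cast
      ring
    rw [e1, integral_complex_ofReal, ← intervalIntegral.integral_of_le zero_le_one,
      intervalIntegral.integral_const_mul, integral_half_eq_half_deriv_cosTransform]
    push_cast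
    ring
  -- `‖T_k e_n‖² = λ(n)² ∫_{−1}^{1} ((ψ_n^{an})′)²`
  have hterm : ∀ n : ℕ,
      ∫ y, ‖∫ x, K y x * b n x ∂((volume : Measure ℝ).restrict (Ioc (0 : ℝ) 1))‖ ^ 2
        ∂((volume : Measure ℝ).restrict (Ioc (0 : ℝ) 1)) =
      prolateEigen n ^ 2 * ∫ y in (-1 : ℝ)..1, deriv (prolateFunAn n) y ^ 2 := by
    intro n
    have e2 : (fun y ↦ ‖∫ x, K y x * b n x ∂((volume : Measure ℝ).restrict (Ioc (0 : ℝ) 1))‖ ^ 2) =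
        fun y ↦ 2 * prolateEigen n ^ 2 * deriv (prolateFunAn n) y ^ 2 := by
      funext y
      rw [hinner n y, Complex.norm_real, Real.norm_eq_abs, sq_abs, mul_pow,
        Real.sq_sqrt zero_le_two, deriv_cosTransform_prolateFun_eq, mul_pow]
      ring
    rw [e2, ← intervalIntegral.integral_of_le zero_le_one, intervalIntegral.integral_const_mul,
      integral_sq_deriv_prolateFunAn_eq_two_mul]
    ring
  -- `∫∫ |k|² = 8π²/3 + 1/2`
  have hK2 : Continuous fun p : ℝ × ℝ ↦ ‖K p.1 p.2‖ ^ 2 := by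
    simp only [hKdef]
    fun_prop
  have hint : Integrable (Function.uncurry fun y x ↦ ‖K y x‖ ^ 2)
      (((volume : Measure ℝ).restrict (Ioc (0 : ℝ) 1)).prod
        ((volume : Measure ℝ).restrict (Ioc (0 : ℝ) 1))) := by
    refine (integrable_const ((4 * π) ^ 2)).mono' hK2.aestronglyMeasurable (ae_of_all _ fun p ↦ ?_)
    rw [Function.uncurry_apply_pair, Real.norm_eq_abs, abs_pow, abs_norm]
    exact pow_le_pow_left₀ (norm_nonneg _) (hC p.1 p.2) 2
  have hin : ∀ x ∈ Ioc (0 : ℝ) 1,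
      ∫ y, ‖K y x‖ ^ 2 ∂((volume : Measure ℝ).restrict (Ioc (0 : ℝ) 1)) =
        8 * π ^ 2 * x ^ 2 - 2 * π * x * Real.sin (4 * π * x) := by
    intro x hx
    have hx0 : x ≠ 0 := hx.1.ne'
    have e : (fun y ↦ ‖K y x‖ ^ 2) = fun y ↦ 16 * π ^ 2 * x ^ 2 * Real.sin (2 * π * x * y) ^ 2 := by
      funext y
      simp only [hKdef, Complex.norm_real, Real.norm_eq_abs, sq_abs,
        hclamp x ⟨by linarith [hx.1], hx.2⟩]
      ring
    rw [e, ← intervalIntegral.integral_of_le zero_le_one, intervalIntegral.integral_const_mul,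
      integral_sin_sq_two_pi_mul hx0]
    field_simp
    ring
  have hval : ∫ y, ∫ x, ‖K y x‖ ^ 2 ∂((volume : Measure ℝ).restrict (Ioc (0 : ℝ) 1))
      ∂((volume : Measure ℝ).restrict (Ioc (0 : ℝ) 1)) = 8 * π ^ 2 / 3 + 1 / 2 := by
    rw [integral_integral_swap hint, setIntegral_congr_fun measurableSet_Ioc hin,
      ← intervalIntegral.integral_of_le zero_le_one, integral_inner_closed_form]
  convert hs using 1
  · funext n
    exact (hterm n).symm
  · exact hval.symm


/-! ### (P4″) The integrated second-derivative identity
`Σ_n λ(n)² ‖(ψ_n^{an})″‖²_{L²(−1,1)} = ∫_{−1}^{1}‖w_y‖² dy = 32π⁴/5 − 2π² + 3/4` -/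

/-- `∫_0^1 ψ_n(x)(−(2πx)²)cos(2πxy) dx = ½ η̃_n″(y)` (evenness fold of `deriv_deriv_cosTransform`). [cite: ConnesConsani2021, App. E p. 35 (arXiv chunk p0035:L16)] -/
private theorem integral_half_eq_half_deriv_deriv_cosTransform (n : ℕ) (y : ℝ) :
    ∫ x in (0 : ℝ)..1, prolateFun n x * (-(2 * π * x) ^ 2 * Real.cos (2 * π * x * y)) =
      1 / 2 * deriv (deriv (cosTransform (prolateFun n))) y := by
  have hψc : ContinuousOn (prolateFun n) (Icc (-1 : ℝ) 1) :=
    (isProlateFunction_prolateFun n).contDiffOn.continuousOn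
  have hcont : ContinuousOn (fun x ↦ prolateFun n x * (-(2 * π * x) ^ 2 * Real.cos (2 * π * x * y)))
      (Icc (-1 : ℝ) 1) :=
    hψc.mul (by fun_prop : Continuous fun x : ℝ ↦
      -(2 * π * x) ^ 2 * Real.cos (2 * π * x * y)).continuousOn
  have h1 : IntervalIntegrable (fun x ↦ prolateFun n x * (-(2 * π * x) ^ 2 * Real.cos (2 * π * x * y)))
      volume (-1) 0 := by
    apply ContinuousOn.intervalIntegrable
    rw [uIcc_of_le (by norm_num : (-1 : ℝ) ≤ 0)]
    exact hcont.mono (Icc_subset_Icc le_rfl zero_le_one)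
  have h2 : IntervalIntegrable (fun x ↦ prolateFun n x * (-(2 * π * x) ^ 2 * Real.cos (2 * π * x * y)))
      volume 0 1 := by
    apply ContinuousOn.intervalIntegrable
    rw [uIcc_of_le (by norm_num : (0 : ℝ) ≤ 1)]
    exact hcont.mono (Icc_subset_Icc (by norm_num) le_rfl)
  rw [congrFun (deriv_deriv_cosTransform (intervalIntegrable_prolateFun' n)) y,
    intervalIntegral_eq_two_mul_of_even (f := fun x ↦ prolateFun n x *
      (-(2 * π * x) ^ 2 * Real.cos (2 * π * x * y))) (fun x ↦ ?_) h1 h2]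
  · ring
  · simp only [prolateFun_neg]
    rw [show 2 * π * -x * y = -(2 * π * x * y) by ring, Real.cos_neg]
    ring

/-- `(ψ_n^{an})″` is even. [cite: ConnesConsani2021, §4 p. 16 (even prolate functions); §5 p. 32] -/
theorem deriv_deriv_prolateFunAn_neg (n : ℕ) (y : ℝ) :
    deriv (deriv (prolateFunAn n)) (-y) = deriv (deriv (prolateFunAn n)) y := by
  have h : (fun x ↦ deriv (prolateFunAn n) (-x)) = fun x ↦ -deriv (prolateFunAn n) x :=
    funext (deriv_prolateFunAn_neg n)
  have h2 := deriv_comp_neg (f := deriv (prolateFunAn n)) (x := y)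
  rw [h] at h2
  have h3 : deriv (fun x ↦ -deriv (prolateFunAn n) x) y = -deriv (deriv (prolateFunAn n)) y :=
    deriv.neg (f := deriv (prolateFunAn n))
  linarith

/-- `∫_{−1}^{1} ((ψ_n^{an})″)² = 2∫_0^1 ((ψ_n^{an})″)²`. [cite: ConnesConsani2021, §4 p. 16 (even prolate functions); §5 p. 32] -/
private theorem integral_sq_deriv_deriv_prolateFunAn_eq_two_mul (n : ℕ) :
    ∫ y in (-1 : ℝ)..1, deriv (deriv (prolateFunAn n)) y ^ 2 =
      2 * ∫ y in (0 : ℝ)..1, deriv (deriv (prolateFunAn n)) y ^ 2 := by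
  have hc : Continuous fun y ↦ deriv (deriv (prolateFunAn n)) y ^ 2 :=
    (continuous_deriv_deriv_prolateFunAn n).pow 2
  exact intervalIntegral_eq_two_mul_of_even (f := fun y ↦ deriv (deriv (prolateFunAn n)) y ^ 2)
    (fun y ↦ by simp only [deriv_deriv_prolateFunAn_neg]) (hc.intervalIntegrable _ _)
    (hc.intervalIntegrable _ _)

/-- `∫_0^1 cos²(2πx·y) dy = 1/2 + sin(4πx)/(8πx)` for `x ≠ 0`. [folklore] -/
private theorem integral_cos_sq_two_pi_mul' {x : ℝ} (hx : x ≠ 0) :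
    ∫ y in (0 : ℝ)..1, Real.cos (2 * π * x * y) ^ 2 = 1 / 2 + Real.sin (4 * π * x) / (8 * π * x) := by
  have hc : 2 * π * x ≠ 0 := by positivity
  have h := intervalIntegral.integral_comp_mul_left (fun u ↦ Real.cos u ^ 2) hc (a := 0) (b := 1)
  rw [h, integral_cos_sq, smul_eq_mul]
  simp only [mul_one, mul_zero, Real.sin_zero, sub_zero]
  rw [show 4 * π * x = 2 * (2 * π * x) by ring, Real.sin_two_mul]
  field_simp
  ring

/-- `∫_0^1 (32π⁴x⁴ + 8π³x³ sin 4πx) dx = 32π⁴/5 − 2π² + 3/4`. [folklore] -/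
private theorem integral_inner_closed_form₂ :
    ∫ x in (0 : ℝ)..1, (32 * π ^ 4 * x ^ 4 + 8 * π ^ 3 * x ^ 3 * Real.sin (4 * π * x)) =
      32 * π ^ 4 / 5 - 2 * π ^ 2 + 3 / 4 := by
  have hπ : π ≠ 0 := Real.pi_ne_zero
  have hF : ∀ x ∈ uIcc (0 : ℝ) 1,
      HasDerivAt (fun x : ℝ ↦ 32 * π ^ 4 * x ^ 5 / 5 - 2 * π ^ 2 * (x ^ 3 * Real.cos (4 * π * x))
        + 3 * π / 2 * (x ^ 2 * Real.sin (4 * π * x)) + 3 / 4 * (x * Real.cos (4 * π * x))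
        - 3 / (16 * π) * Real.sin (4 * π * x))
        (32 * π ^ 4 * x ^ 4 + 8 * π ^ 3 * x ^ 3 * Real.sin (4 * π * x)) x := by
    intro x _
    have hs : HasDerivAt (fun x : ℝ ↦ Real.sin (4 * π * x)) (4 * π * Real.cos (4 * π * x)) x := by
      have := ((hasDerivAt_id x).const_mul (4 * π)).sin
      simpa [mul_comm] using this
    have hc : HasDerivAt (fun x : ℝ ↦ Real.cos (4 * π * x)) (-(4 * π * Real.sin (4 * π * x))) x := by
      have := ((hasDerivAt_id x).const_mul (4 * π)).cos
      simpa [mul_comm] using this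
    have h1 := ((hasDerivAt_pow 5 x).const_mul (32 * π ^ 4)).div_const 5
    have h2 := ((hasDerivAt_pow 3 x).mul hc).const_mul (2 * π ^ 2)
    have h3 := ((hasDerivAt_pow 2 x).mul hs).const_mul (3 * π / 2)
    have h4 := ((hasDerivAt_id x).mul hc).const_mul (3 / 4 : ℝ)
    have h5 := hs.const_mul (3 / (16 * π))
    have h := (((h1.sub h2).add h3).add h4).sub h5
    have h' := h.congr_of_eventuallyEq (f₁ := fun x : ℝ ↦ 32 * π ^ 4 * x ^ 5 / 5
        - 2 * π ^ 2 * (x ^ 3 * Real.cos (4 * π * x)) + 3 * π / 2 * (x ^ 2 * Real.sin (4 * π * x))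
        + 3 / 4 * (x * Real.cos (4 * π * x)) - 3 / (16 * π) * Real.sin (4 * π * x))
      (Eventually.of_forall fun z ↦ by
        simp only [Pi.add_apply, Pi.sub_apply, Pi.mul_apply, id_eq])
    refine h'.congr_deriv ?_
    norm_num [id_eq]
    field_simp
    ring
  have hint : IntervalIntegrable
      (fun x : ℝ ↦ 32 * π ^ 4 * x ^ 4 + 8 * π ^ 3 * x ^ 3 * Real.sin (4 * π * x)) volume 0 1 :=
    (by fun_prop : Continuous fun x : ℝ ↦
      32 * π ^ 4 * x ^ 4 + 8 * π ^ 3 * x ^ 3 * Real.sin (4 * π * x)).intervalIntegrable _ _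
  rw [intervalIntegral.integral_eq_sub_of_hasDerivAt hF hint]
  have hc : Real.cos (4 * π) = 1 := by
    rw [show (4 : ℝ) * π = 2 * π + 2 * π by ring, Real.cos_add_two_pi, Real.cos_two_pi]
  have hs : Real.sin (4 * π) = 0 := by
    rw [show (4 : ℝ) * π = 2 * π + 2 * π by ring, Real.sin_add_two_pi, Real.sin_two_pi]
  simp only [mul_one, one_pow, hc, mul_zero, Real.sin_zero, Real.cos_zero]
  rw [hs]
  ring

/-- **(P4″) Integrated second-derivative Parseval**:
`Σ_n λ(n)² ∫_{−1}^{1}(ψ_n^{an})″(y)² dy = 32π⁴/5 − 2π² + 3/4` (`= ∫_{−1}^{1}‖w_y‖²dy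
= ∫∫_{[−1,1]²}(2πx)⁴cos²(2πxy)`; Hilbert–Schmidt norm of the kernel `−(2πx)²cos(2πxy)` on even inputs).
[cite: ConnesConsani2021, Remark 4.6 (i) §4 p. 18 (arXiv item Remark 26; same road as `Σλ(n)² = δ(1)`); Prop. 4.5 (ii) p. 17; App. E p. 35 (p0035:L16); Bump1997, Ch. 2 §2.3 Thm. 2.3.2] -/
theorem hasSum_sq_prolateEigen_mul_integral_sq_deriv_deriv_prolateFunAn :
    HasSum (fun n : ℕ ↦ prolateEigen n ^ 2 * ∫ y in (-1 : ℝ)..1, deriv (deriv (prolateFunAn n)) y ^ 2)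
      (32 * π ^ 4 / 5 - 2 * π ^ 2 + 3 / 4) := by
  haveI : IsFiniteMeasure ((volume : Measure ℝ).restrict (Ioc (0 : ℝ) 1)) :=
    isFiniteMeasure_restrict.2 measure_Ioc_lt_top.ne
  set b : HilbertBasis ℕ ℂ (Lp ℂ 2 ((volume : Measure ℝ).restrict (Ioc (0 : ℝ) 1))) :=
    HilbertBasis.mkOfOrthogonalEqBot orthonormal_toLp_sqrt_two_mul_prolateXiFun
      (orthogonal_span_toLp_sqrt_two_mul_prolateXiFun_eq_bot CC2021_sec4_xi_complete_holds) with hbdef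
  have hb : ∀ n : ℕ, (b n : Lp ℂ 2 ((volume : Measure ℝ).restrict (Ioc (0 : ℝ) 1)))
      = (memLp_sqrt_two_mul_prolateXiFun_restrict n).toLp _ := fun n ↦ by
    rw [hbdef, HilbertBasis.coe_mkOfOrthogonalEqBot]
  set K : ℝ → ℝ → ℂ := fun y x ↦
    ((2 * (-(2 * π * max (-1) (min x 1)) ^ 2 * Real.cos (2 * π * x * y)) : ℝ) : ℂ) with hKdef
  have hclamp : ∀ x ∈ Icc (-1 : ℝ) 1, max (-1) (min x 1) = x := fun x hx ↦ by
    rw [min_eq_left hx.2, max_eq_right hx.1]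
  have hK : StronglyMeasurable (Function.uncurry K) := by
    apply Continuous.stronglyMeasurable
    simp only [hKdef, Function.uncurry_def]
    fun_prop
  have hC : ∀ y x, ‖K y x‖ ≤ 8 * π ^ 2 := fun y x ↦ by
    simp only [hKdef, Complex.norm_real, Real.norm_eq_abs]
    have h1 : |max (-1) (min x 1)| ≤ 1 :=
      abs_le.2 ⟨le_max_left _ _, max_le (by norm_num) (min_le_right _ _)⟩
    have h0 : 0 ≤ |max (-1) (min x 1)| := abs_nonneg _
    have h2 := Real.abs_cos_le_one (2 * π * x * y)
    have h3 : 0 ≤ |Real.cos (2 * π * x * y)| := abs_nonneg _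
    rw [abs_mul, abs_mul, abs_neg, abs_pow, abs_mul, abs_of_pos (by positivity : (0 : ℝ) < 2 * π),
      abs_two]
    calc 2 * ((2 * π * |max (-1) (min x 1)|) ^ 2 * |Real.cos (2 * π * x * y)|)
        ≤ 2 * ((2 * π * 1) ^ 2 * 1) := by gcongr
      _ = 8 * π ^ 2 := by ring
  have hs := Literature.Analysis.OperatorTheory.hasSum_integral_norm_sq_integral_kernel_mul hK hC b
  have hinner : ∀ (n : ℕ) (y : ℝ),
      ∫ x, K y x * b n x ∂((volume : Measure ℝ).restrict (Ioc (0 : ℝ) 1)) =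
        ((Real.sqrt 2 * deriv (deriv (cosTransform (prolateFun n))) y : ℝ) : ℂ) := by
    intro n y
    have e1 : ∫ x, K y x * b n x ∂((volume : Measure ℝ).restrict (Ioc (0 : ℝ) 1)) =
        ∫ x in Ioc (0 : ℝ) 1, (((2 * Real.sqrt 2) *
          (prolateFun n x * (-(2 * π * x) ^ 2 * Real.cos (2 * π * x * y))) : ℝ) : ℂ) := by
      refine integral_congr_ae ?_
      rw [hb n]
      filter_upwards [(memLp_sqrt_two_mul_prolateXiFun_restrict n).coeFn_toLp,
        ae_restrict_mem measurableSet_Ioc] with x hx hxI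
      rw [hx]
      simp only [hKdef, prolateXiFun, hclamp x ⟨by linarith [hxI.1], hxI.2⟩]
      push_cast
      ring
    rw [e1, integral_complex_ofReal, ← intervalIntegral.integral_of_le zero_le_one,
      intervalIntegral.integral_const_mul, integral_half_eq_half_deriv_deriv_cosTransform]
    push_cast
    ring
  have hterm : ∀ n : ℕ,
      ∫ y, ‖∫ x, K y x * b n x ∂((volume : Measure ℝ).restrict (Ioc (0 : ℝ) 1))‖ ^ 2
        ∂((volume : Measure ℝ).restrict (Ioc (0 : ℝ) 1)) =
      prolateEigen n ^ 2 * ∫ y in (-1 : ℝ)..1, deriv (deriv (prolateFunAn n)) y ^ 2 := by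
    intro n
    have e2 : (fun y ↦ ‖∫ x, K y x * b n x ∂((volume : Measure ℝ).restrict (Ioc (0 : ℝ) 1))‖ ^ 2) =
        fun y ↦ 2 * prolateEigen n ^ 2 * deriv (deriv (prolateFunAn n)) y ^ 2 := by
      funext y
      rw [hinner n y, Complex.norm_real, Real.norm_eq_abs, sq_abs, mul_pow,
        Real.sq_sqrt zero_le_two, deriv_deriv_cosTransform_prolateFun_eq, mul_pow]
      ring
    rw [e2, ← intervalIntegral.integral_of_le zero_le_one, intervalIntegral.integral_const_mul,
      integral_sq_deriv_deriv_prolateFunAn_eq_two_mul]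
    ring
  have hK2 : Continuous fun p : ℝ × ℝ ↦ ‖K p.1 p.2‖ ^ 2 := by
    simp only [hKdef]
    fun_prop
  have hint : Integrable (Function.uncurry fun y x ↦ ‖K y x‖ ^ 2)
      (((volume : Measure ℝ).restrict (Ioc (0 : ℝ) 1)).prod
        ((volume : Measure ℝ).restrict (Ioc (0 : ℝ) 1))) := by
    refine (integrable_const ((8 * π ^ 2) ^ 2)).mono' hK2.aestronglyMeasurable
      (ae_of_all _ fun p ↦ ?_)
    rw [Function.uncurry_apply_pair, Real.norm_eq_abs, abs_pow, abs_norm]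
    exact pow_le_pow_left₀ (norm_nonneg _) (hC p.1 p.2) 2
  have hin : ∀ x ∈ Ioc (0 : ℝ) 1,
      ∫ y, ‖K y x‖ ^ 2 ∂((volume : Measure ℝ).restrict (Ioc (0 : ℝ) 1)) =
        32 * π ^ 4 * x ^ 4 + 8 * π ^ 3 * x ^ 3 * Real.sin (4 * π * x) := by
    intro x hx
    have hx0 : x ≠ 0 := hx.1.ne'
    have e : (fun y ↦ ‖K y x‖ ^ 2) = fun y ↦ 64 * π ^ 4 * x ^ 4 * Real.cos (2 * π * x * y) ^ 2 := by
      funext y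
      simp only [hKdef, Complex.norm_real, Real.norm_eq_abs, sq_abs,
        hclamp x ⟨by linarith [hx.1], hx.2⟩]
      ring
    rw [e, ← intervalIntegral.integral_of_le zero_le_one, intervalIntegral.integral_const_mul,
      integral_cos_sq_two_pi_mul' hx0]
    field_simp
    ring
  have hval : ∫ y, ∫ x, ‖K y x‖ ^ 2 ∂((volume : Measure ℝ).restrict (Ioc (0 : ℝ) 1))
      ∂((volume : Measure ℝ).restrict (Ioc (0 : ℝ) 1)) = 32 * π ^ 4 / 5 - 2 * π ^ 2 + 3 / 4 := by
    rw [integral_integral_swap hint, setIntegral_congr_fun measurableSet_Ioc hin,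
      ← intervalIntegral.integral_of_le zero_le_one, integral_inner_closed_form₂]
  convert hs using 1
  · funext n
    exact (hterm n).symm
  · exact hval.symm

end Integrated

end Literature.NumberTheory.ConnesConsani2021

end
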